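import Mathlib
import Summits.ValiantsHypothesis.ValiantsHypothesis.Theorems.LacunarySymmetroidMatrixDescartesDetLorentzianDefinite
import HarnessLib

/-!
# ValiantsHypothesis / LacunarySymmetroid — crux `MatrixDescartes` (stmt-ValiantsHypothesis-18050, V1),
# line `Cruxes/MatrixDescartes/Lines/lorentzian_shadow.lean`: the HESSIAN conjunct (d) of `DetLorentzian` at `m = 2`,
# and `stub_detLorentzian` outright for definite `2 × 2` tuples

The line's KNOWN stub `stub_detLorentzian : DetLorentzian` asks for `IsLorentzianArray m K (detArray m K A)` =
(a) nonnegative coefficients ∧ (b) support in the layer `Δ(m,K)` ∧ (c) M-convex support ∧ (d) for every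
`γ ∈ Δ(m−2,K)`, `AtMostOnePosEig (hessAt c γ)` — the Hessian `H_γ(i,j) = (γ+e_i+e_j)! · c(γ+e_i+e_j)` of the
`γ`-th partial has at most one positive eigenvalue, in the eigenvalue-free form
`0 < vᵀHv → (vᵀHv)(wᵀHw) ≤ (vᵀHw)²` (reverse Cauchy–Schwarz).  THIS FILE proves (d) for `m = 2`, all `K`,
for arbitrary tuples of real SYMMETRIC `2 × 2` matrices (`0` named facts, no definitions):

* at `m = 2` the only `γ` is `0`, and `hessAt (detArray 2 K A) 0 (i,j) = a_i d_j + a_j d_i − 2 b_i b_j`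
  (`A_l = [[a_l, b_l],[b_l, d_l]]`; `hessEntry`: the polarised `2 × 2` determinant, uniformly in `i, j` thanks to
  the factor `(e_i+e_j)! = 2^{[i=j]}`, `factWeight_pair`, `coeff_pair_linear_mul`);
* hence `vᵀHw = V₁₁W₂₂ + V₂₂W₁₁ − 2V₁₂W₁₂` and `vᵀHv = 2 det V` for `V = Σ v_l A_l`, `W = Σ w_l A_l` (`form_eq`);
* `det` on `Sym₂(ℝ) ≅ ℝ³` is the Lorentz form `ac − b²` (signature `(1,2)`), whose reverse Cauchy–Schwarz
  inequality `det V > 0 ⇒ det V · det W ≤ D(V,W)²` is `det_two_reverse_cauchy_schwarz`, proved by the explicit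
  identity `4a²(B² − QQ′) = (2aB − 2Qx)² + 4Q(ay − bx)²`;
* **`atMostOnePosEig_hessAt_detArray_two`** = conjunct (d) of `IsLorentzianArray 2 K (detArray 2 K A)` in the
  line's currency (`layer`, `hessAt`, `factWeight`, `AtMostOnePosEig`, `detArray` UNFOLDED — the line file is not
  importable from `Theorems/`; it closes the conjunct by `exact`);
* **`isLorentzianArray_detArray_two_of_posDef`** = ALL FOUR conjuncts, i.e. `stub_detLorentzian` OUTRIGHT, for
  positive definite `2 × 2` tuples: (a)(b) `DetLorentzian.*` (val-lit-p7, `…DetLorentzianNonneg.lean`) and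
  (c-definite) `DetLorentzianDefinite.isLorentzianArray_parts_abc_of_posDef` (`…DetLorentzianDefinite.lean`) by name.

Residual of `stub_detLorentzian`: (d) for `m ≥ 3` (Gårding hyperbolicity of `det` / Aleksandrov's mixed
discriminant inequality + Brändén–Huh "stable ⇒ Lorentzian"), and (c) for singular PSD tuples (Rado sufficiency,
`…DetLorentzianPolymatroidExchange.lean` / `…RankNecessity.lean`).  Honest framing: helper lemmas on an unregistered
ALTERNATIVE line of the V1 crux; the laws `stub_lorentzianDescartes`, `MatrixDescartes`, Conjecture B and
`VP ≠ VNP` stay OPEN / NOT proved.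
-/

-- `Summit.ValiantsHypothesis.ValiantsHypothesis.…` is the tree's mandated single-conjunct layout (Sub = Summit).
set_option linter.dupNamespace false

noncomputable section

namespace Summit.ValiantsHypothesis.ValiantsHypothesis.Theorems.LacunarySymmetroidMatrixDescartes

open Matrix Finset
open scoped BigOperators MatrixOrder

namespace DetLorentzianHessianTwo

variable {K : ℕ}

/-! ### The Lorentz form `det` on `Sym₂(ℝ)`: reverse Cauchy–Schwarz -/

/-- **Reverse Cauchy–Schwarz for the `2 × 2` determinant of symmetric matrices** (`det` on `Sym₂(ℝ)` has
signature `(1,2)`): if `V = [[a,b],[b,c]]` has `det V > 0` then for every `W = [[x,y],[y,z]]`,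
`det V · det W ≤ D(V,W)²` with `D(V,W) = (az + cx)/2 − by` the polarised determinant.  Proof: the identity
`4a²(D² − det V det W) = (2aD − 2 det V · x)² + 4 det V (ay − bx)²`. [folklore] -/
theorem det_two_reverse_cauchy_schwarz (a b c x y z : ℝ) (hQ : 0 < a * c - b ^ 2) :
    (a * c - b ^ 2) * (x * z - y ^ 2) ≤ ((a * z + c * x) / 2 - b * y) ^ 2 := by
  have ha : a ≠ 0 := by
    rintro rfl
    nlinarith [sq_nonneg b]
  have h4a : 0 < 4 * a ^ 2 := by positivity
  have key : 4 * a ^ 2 * (((a * z + c * x) / 2 - b * y) ^ 2 - (a * c - b ^ 2) * (x * z - y ^ 2)) =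
      (2 * a * ((a * z + c * x) / 2 - b * y) - 2 * (a * c - b ^ 2) * x) ^ 2 +
        4 * (a * c - b ^ 2) * (a * y - b * x) ^ 2 := by
    ring
  have hnn : 0 ≤ 4 * a ^ 2 * (((a * z + c * x) / 2 - b * y) ^ 2 - (a * c - b ^ 2) * (x * z - y ^ 2)) := by
    rw [key]
    exact add_nonneg (sq_nonneg _) (mul_nonneg (mul_nonneg (by norm_num) hQ.le) (sq_nonneg _))
  exact sub_nonneg.1 ((mul_nonneg_iff_of_pos_left h4a).1 hnn)

/-! ### Coefficients of a product of two linear forms -/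

/-- A product of two linear forms `(Σ_l p_l s_l)(Σ_l q_l s_l)` as a double sum of monomials. [folklore] -/
theorem linear_mul_linear (p q : Fin K → ℝ) :
    (∑ l, (MvPolynomial.X l : MvPolynomial (Fin K) ℝ) * MvPolynomial.C (p l)) *
        (∑ l, (MvPolynomial.X l : MvPolynomial (Fin K) ℝ) * MvPolynomial.C (q l)) =
      ∑ l, ∑ l', MvPolynomial.monomial (Finsupp.single l 1 + Finsupp.single l' 1) (p l * q l') := by
  rw [Finset.sum_mul_sum]
  refine Finset.sum_congr rfl fun l _ => Finset.sum_congr rfl fun l' _ => ?_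
  rw [mul_comm (MvPolynomial.X l), mul_comm (MvPolynomial.X l'), MvPolynomial.C_mul_X_eq_monomial,
    MvPolynomial.C_mul_X_eq_monomial, MvPolynomial.monomial_mul]

/-- **The coefficient of `s_i s_j` in `(Σ_l p_l s_l)(Σ_l q_l s_l)`**: `p_i q_i` on the diagonal, `p_i q_j + p_j q_i`
off it. [folklore] -/
theorem coeff_pair_linear_mul (p q : Fin K → ℝ) (i j : Fin K) :
    MvPolynomial.coeff (Finsupp.single i 1 + Finsupp.single j 1)
        ((∑ l, (MvPolynomial.X l : MvPolynomial (Fin K) ℝ) * MvPolynomial.C (p l)) *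
          (∑ l, (MvPolynomial.X l : MvPolynomial (Fin K) ℝ) * MvPolynomial.C (q l))) =
      if i = j then p i * q i else p i * q j + p j * q i := by
  classical
  rw [linear_mul_linear, MvPolynomial.coeff_sum]
  simp_rw [MvPolynomial.coeff_sum, MvPolynomial.coeff_monomial]
  have key : ∀ l l' : Fin K, (Finsupp.single l 1 + Finsupp.single l' 1 =
      Finsupp.single i 1 + Finsupp.single j 1) ↔ (l = i ∧ l' = j) ∨ (l = j ∧ l' = i) := by
    intro l l'
    rw [Finsupp.single_add_single_eq_single_add_single one_ne_zero one_ne_zero]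
    simp
  simp_rw [key]
  by_cases hij : i = j
  · subst hij
    simp only [or_self, if_true]
    rw [Finset.sum_eq_single i (fun l _ hl => by simp [hl]) (by simp),
      Finset.sum_eq_single i (fun l' _ hl' => by simp [hl']) (by simp)]
    simp
  · rw [if_neg hij, Finset.sum_eq_add i j hij (fun l _ hl => by simp [hl.1, hl.2]) (by simp) (by simp)]
    congr 1
    · rw [Finset.sum_eq_single j (fun l' _ hl' => by simp [hl', hij]) (by simp)]
      simp
    · rw [Finset.sum_eq_single i (fun l' _ hl' => by simp [hl', Ne.symm hij]) (by simp)]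
      simp [Ne.symm hij]

/-- The normalising factor `(e_i + e_j)! = ∏_k ((e_i+e_j)_k)!` is `2` on the diagonal and `1` off it. [folklore] -/
theorem factWeight_pair (i j : Fin K) :
    (∏ k, ((Pi.single i 1 + Pi.single j 1 : Fin K → ℕ) k).factorial) = if i = j then 2 else 1 := by
  rw [Finset.prod_eq_single i]
  · simp only [Pi.add_apply, Pi.single_eq_same]
    by_cases hij : i = j
    · subst hij
      rw [Pi.single_eq_same, if_pos rfl]
      rfl
    · rw [Pi.single_eq_of_ne hij, if_neg hij]
      rfl
  · intro k _ hk
    simp only [Pi.add_apply, Pi.single_eq_of_ne hk, zero_add]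
    rcases eq_or_ne k j with rfl | hkj
    · rw [Pi.single_eq_same]
      rfl
    · rw [Pi.single_eq_of_ne hkj]
      rfl
  · simp

/-! ### The Hessian of `det Σ_l s_l A_l` for `2 × 2` symmetric tuples -/

/-- **Hessian entry.** For symmetric `A_l = [[a_l,b_l],[b_l,d_l]]`,
`(e_i+e_j)! · [s_i s_j] det Σ_l s_l A_l = a_i d_j + a_j d_i − 2 b_i b_j` (uniformly in `i, j`). [folklore] -/
theorem hessEntry (A : Fin K → Matrix (Fin 2) (Fin 2) ℝ) (hA : ∀ l, (A l).IsSymm) (i j : Fin K) :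
    ((∏ k, ((Pi.single i 1 + Pi.single j 1 : Fin K → ℕ) k).factorial : ℕ) : ℝ) *
        MvPolynomial.coeff (Finsupp.equivFunOnFinite.symm (Pi.single i 1 + Pi.single j 1 : Fin K → ℕ))
          (Matrix.det (∑ l, (MvPolynomial.X l : MvPolynomial (Fin K) ℝ) • (A l).map MvPolynomial.C)) =
      A i 0 0 * A j 1 1 + A j 0 0 * A i 1 1 - 2 * (A i 0 1 * A j 0 1) := by
  classical
  have hd : Finsupp.equivFunOnFinite.symm (Pi.single i 1 + Pi.single j 1 : Fin K → ℕ) =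
      Finsupp.single i 1 + Finsupp.single j 1 := by
    ext k
    simp only [Finsupp.coe_equivFunOnFinite_symm, Pi.add_apply, Finsupp.coe_add, Finsupp.single_eq_pi_single]
  have h10 : ∀ l, A l 1 0 = A l 0 1 := fun l => (hA l).apply 0 1
  have hdet : Matrix.det (∑ l, (MvPolynomial.X l : MvPolynomial (Fin K) ℝ) • (A l).map MvPolynomial.C) =
      (∑ l, (MvPolynomial.X l : MvPolynomial (Fin K) ℝ) * MvPolynomial.C (A l 0 0)) *
          (∑ l, (MvPolynomial.X l : MvPolynomial (Fin K) ℝ) * MvPolynomial.C (A l 1 1)) -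
        (∑ l, (MvPolynomial.X l : MvPolynomial (Fin K) ℝ) * MvPolynomial.C (A l 0 1)) *
          (∑ l, (MvPolynomial.X l : MvPolynomial (Fin K) ℝ) * MvPolynomial.C (A l 0 1)) := by
    rw [Matrix.det_fin_two, DetCurve.genericPencil_apply, DetCurve.genericPencil_apply,
      DetCurve.genericPencil_apply, DetCurve.genericPencil_apply]
    simp_rw [h10]
  rw [hd, hdet, MvPolynomial.coeff_sub, coeff_pair_linear_mul, coeff_pair_linear_mul, factWeight_pair]
  by_cases hij : i = j
  · subst hij
    simp only [if_true]
    push_cast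
    ring
  · simp only [if_neg hij]
    push_cast
    ring

/-- **The Hessian bilinear form is the polarised determinant**: for `H(i,j) = a_i d_j + a_j d_i − 2 b_i b_j`,
`vᵀ H w = (v·a)(w·d) + (v·d)(w·a) − 2 (v·b)(w·b)` (= `V₁₁W₂₂ + V₂₂W₁₁ − 2V₁₂W₁₂` for `V = Σ v_l A_l`,
`W = Σ w_l A_l`). [folklore] -/
theorem form_eq (a b d v w : Fin K → ℝ) :
    v ⬝ᵥ ((fun i j : Fin K => a i * d j + a j * d i - 2 * (b i * b j)) *ᵥ w) =
      (∑ i, v i * a i) * (∑ j, w j * d j) + (∑ i, v i * d i) * (∑ j, w j * a j) -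
        2 * ((∑ i, v i * b i) * (∑ j, w j * b j)) := by
  have key : ∀ p q : Fin K → ℝ,
      (∑ i, v i * p i) * (∑ j, w j * q j) = ∑ i, ∑ j, v i * (p i * q j) * w j := by
    intro p q
    rw [Finset.sum_mul_sum]
    exact Finset.sum_congr rfl fun i _ => Finset.sum_congr rfl fun j _ => by ring
  rw [key, key, key, Finset.mul_sum, ← Finset.sum_add_distrib, ← Finset.sum_sub_distrib]
  simp only [dotProduct, Matrix.mulVec]
  refine Finset.sum_congr rfl fun i _ => ?_
  rw [Finset.mul_sum, Finset.mul_sum, ← Finset.sum_add_distrib, ← Finset.sum_sub_distrib]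
  exact Finset.sum_congr rfl fun j _ => by ring

/-- **(d) at `m = 2`, in the line's currency** (`layer (2−2) K`, `hessAt`, `factWeight`, `detArray`,
`AtMostOnePosEig` UNFOLDED): for every tuple of real SYMMETRIC `2 × 2` matrices `A_l` and the only
`γ ∈ Δ(0,K)` (namely `γ = 0`), the Hessian `H(i,j) = (γ+e_i+e_j)! · [s^{γ+e_i+e_j}] det Σ_l s_l A_l` satisfies
`0 < vᵀHv → (vᵀHv)(wᵀHw) ≤ (vᵀHw)²` — reverse Cauchy–Schwarz for the Lorentz form `det` on `Sym₂(ℝ)` pulled back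
along `v ↦ Σ v_l A_l`.  Positive semidefiniteness is not needed, symmetry is. [folklore] -/
theorem atMostOnePosEig_hessAt_detArray_two (K : ℕ) (A : Fin K → Matrix (Fin 2) (Fin 2) ℝ)
    (hA : ∀ l, (A l).IsSymm) :
    ∀ γ ∈ (Fintype.piFinset fun _ : Fin K => Finset.range (2 - 2 + 1)).filter (fun α => ∑ i, α i = 2 - 2),
      ∀ v w : Fin K → ℝ,
        0 < v ⬝ᵥ ((fun i j : Fin K =>
              ((∏ k, ((γ + Pi.single i 1 + Pi.single j 1 : Fin K → ℕ) k).factorial : ℕ) : ℝ) *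
                MvPolynomial.coeff (Finsupp.equivFunOnFinite.symm (γ + Pi.single i 1 + Pi.single j 1))
                  (Matrix.det (∑ l, (MvPolynomial.X l : MvPolynomial (Fin K) ℝ) • (A l).map MvPolynomial.C)))
            *ᵥ v) →
          (v ⬝ᵥ ((fun i j : Fin K =>
              ((∏ k, ((γ + Pi.single i 1 + Pi.single j 1 : Fin K → ℕ) k).factorial : ℕ) : ℝ) *
                MvPolynomial.coeff (Finsupp.equivFunOnFinite.symm (γ + Pi.single i 1 + Pi.single j 1))
                  (Matrix.det (∑ l, (MvPolynomial.X l : MvPolynomial (Fin K) ℝ) • (A l).map MvPolynomial.C)))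
            *ᵥ v)) *
            (w ⬝ᵥ ((fun i j : Fin K =>
              ((∏ k, ((γ + Pi.single i 1 + Pi.single j 1 : Fin K → ℕ) k).factorial : ℕ) : ℝ) *
                MvPolynomial.coeff (Finsupp.equivFunOnFinite.symm (γ + Pi.single i 1 + Pi.single j 1))
                  (Matrix.det (∑ l, (MvPolynomial.X l : MvPolynomial (Fin K) ℝ) • (A l).map MvPolynomial.C)))
            *ᵥ w)) ≤
          (v ⬝ᵥ ((fun i j : Fin K =>
              ((∏ k, ((γ + Pi.single i 1 + Pi.single j 1 : Fin K → ℕ) k).factorial : ℕ) : ℝ) *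
                MvPolynomial.coeff (Finsupp.equivFunOnFinite.symm (γ + Pi.single i 1 + Pi.single j 1))
                  (Matrix.det (∑ l, (MvPolynomial.X l : MvPolynomial (Fin K) ℝ) • (A l).map MvPolynomial.C)))
            *ᵥ w)) ^ 2 := by
  classical
  intro γ hγ v w hv
  -- the only `γ` on the layer `Δ(0,K)` is `0`
  obtain rfl : γ = 0 := by
    have hs : ∑ i, γ i = 0 := by simpa using (Finset.mem_filter.1 hγ).2
    funext k
    exact Finset.sum_eq_zero_iff.1 hs k (Finset.mem_univ k)
  -- the Hessian entries
  have hH : (fun i j : Fin K =>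
      ((∏ k, (((0 : Fin K → ℕ) + Pi.single i 1 + Pi.single j 1 : Fin K → ℕ) k).factorial : ℕ) : ℝ) *
        MvPolynomial.coeff (Finsupp.equivFunOnFinite.symm ((0 : Fin K → ℕ) + Pi.single i 1 + Pi.single j 1))
          (Matrix.det (∑ l, (MvPolynomial.X l : MvPolynomial (Fin K) ℝ) • (A l).map MvPolynomial.C))) =
      fun i j : Fin K => A i 0 0 * A j 1 1 + A j 0 0 * A i 1 1 - 2 * (A i 0 1 * A j 0 1) := by
    funext i j
    rw [zero_add]
    exact hessEntry A hA i j
  rw [hH] at hv ⊢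
  rw [form_eq] at hv ⊢
  rw [form_eq, form_eq]
  -- reverse Cauchy–Schwarz for `det` on `Sym₂(ℝ)`
  have hQ : 0 < (∑ i, v i * A i 0 0) * (∑ i, v i * A i 1 1) - (∑ i, v i * A i 0 1) ^ 2 := by
    nlinarith [hv]
  have hcs := det_two_reverse_cauchy_schwarz (∑ i, v i * A i 0 0) (∑ i, v i * A i 0 1) (∑ i, v i * A i 1 1)
    (∑ j, w j * A j 0 0) (∑ j, w j * A j 0 1) (∑ j, w j * A j 1 1) hQ
  nlinarith [hcs]

/-- **`stub_detLorentzian` OUTRIGHT for positive definite `2 × 2` tuples**: all four conjuncts of the line's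
`IsLorentzianArray 2 K (detArray 2 K A)` (UNFOLDED; the line closes it by `exact`) for `A_l ≻ 0` —
(a)(b) `DetLorentzian.detArray_nonneg_of_posSemidef` / `detArray_eq_zero_of_not_mem_layer` (val-lit-p7) and
(c) `DetLorentzianDefinite.isLorentzianArray_parts_abc_of_posDef` by name, (d) `atMostOnePosEig_hessAt_detArray_two`.
The first complete case of "PSD determinantal pencils are Lorentzian" (Brändén–Huh) in the tree; the laws and the
crux stay OPEN. [folklore] -/
theorem isLorentzianArray_detArray_two_of_posDef (K : ℕ) (A : Fin K → Matrix (Fin 2) (Fin 2) ℝ)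
    (hA : ∀ l, (A l).PosDef) :
    (∀ α : Fin K → ℕ, 0 ≤ MvPolynomial.coeff (Finsupp.equivFunOnFinite.symm α)
      (Matrix.det (∑ l, (MvPolynomial.X l : MvPolynomial (Fin K) ℝ) • (A l).map MvPolynomial.C))) ∧
    (∀ α : Fin K → ℕ,
      α ∉ (Fintype.piFinset fun _ : Fin K => Finset.range (2 + 1)).filter (fun α => ∑ i, α i = 2) →
      MvPolynomial.coeff (Finsupp.equivFunOnFinite.symm α)
        (Matrix.det (∑ l, (MvPolynomial.X l : MvPolynomial (Fin K) ℝ) • (A l).map MvPolynomial.C)) = 0) ∧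
    (∀ α ∈ ((Fintype.piFinset fun _ : Fin K => Finset.range (2 + 1)).filter (fun α => ∑ i, α i = 2)).filter
        (fun α => MvPolynomial.coeff (Finsupp.equivFunOnFinite.symm α)
          (Matrix.det (∑ l, (MvPolynomial.X l : MvPolynomial (Fin K) ℝ) • (A l).map MvPolynomial.C)) ≠ 0),
      ∀ β ∈ ((Fintype.piFinset fun _ : Fin K => Finset.range (2 + 1)).filter (fun α => ∑ i, α i = 2)).filter
        (fun α => MvPolynomial.coeff (Finsupp.equivFunOnFinite.symm α)
          (Matrix.det (∑ l, (MvPolynomial.X l : MvPolynomial (Fin K) ℝ) • (A l).map MvPolynomial.C)) ≠ 0),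
      ∀ i : Fin K, β i < α i →
        ∃ j : Fin K, α j < β j ∧
          (α - Pi.single i 1 + Pi.single j 1) ∈
            ((Fintype.piFinset fun _ : Fin K => Finset.range (2 + 1)).filter (fun α => ∑ i, α i = 2)).filter
              (fun α => MvPolynomial.coeff (Finsupp.equivFunOnFinite.symm α)
                (Matrix.det (∑ l, (MvPolynomial.X l : MvPolynomial (Fin K) ℝ) • (A l).map MvPolynomial.C)) ≠ 0) ∧
          (β - Pi.single j 1 + Pi.single i 1) ∈
            ((Fintype.piFinset fun _ : Fin K => Finset.range (2 + 1)).filter (fun α => ∑ i, α i = 2)).filter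
              (fun α => MvPolynomial.coeff (Finsupp.equivFunOnFinite.symm α)
                (Matrix.det (∑ l, (MvPolynomial.X l : MvPolynomial (Fin K) ℝ) • (A l).map MvPolynomial.C)) ≠ 0) ∧
          (0 : ℚ) + 0 ≤ 0 + 0) ∧
    (∀ γ ∈ (Fintype.piFinset fun _ : Fin K => Finset.range (2 - 2 + 1)).filter (fun α => ∑ i, α i = 2 - 2),
      ∀ v w : Fin K → ℝ,
        0 < v ⬝ᵥ ((fun i j : Fin K =>
              ((∏ k, ((γ + Pi.single i 1 + Pi.single j 1 : Fin K → ℕ) k).factorial : ℕ) : ℝ) *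
                MvPolynomial.coeff (Finsupp.equivFunOnFinite.symm (γ + Pi.single i 1 + Pi.single j 1))
                  (Matrix.det (∑ l, (MvPolynomial.X l : MvPolynomial (Fin K) ℝ) • (A l).map MvPolynomial.C)))
            *ᵥ v) →
          (v ⬝ᵥ ((fun i j : Fin K =>
              ((∏ k, ((γ + Pi.single i 1 + Pi.single j 1 : Fin K → ℕ) k).factorial : ℕ) : ℝ) *
                MvPolynomial.coeff (Finsupp.equivFunOnFinite.symm (γ + Pi.single i 1 + Pi.single j 1))
                  (Matrix.det (∑ l, (MvPolynomial.X l : MvPolynomial (Fin K) ℝ) • (A l).map MvPolynomial.C)))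
            *ᵥ v)) *
            (w ⬝ᵥ ((fun i j : Fin K =>
              ((∏ k, ((γ + Pi.single i 1 + Pi.single j 1 : Fin K → ℕ) k).factorial : ℕ) : ℝ) *
                MvPolynomial.coeff (Finsupp.equivFunOnFinite.symm (γ + Pi.single i 1 + Pi.single j 1))
                  (Matrix.det (∑ l, (MvPolynomial.X l : MvPolynomial (Fin K) ℝ) • (A l).map MvPolynomial.C)))
            *ᵥ w)) ≤
          (v ⬝ᵥ ((fun i j : Fin K =>
              ((∏ k, ((γ + Pi.single i 1 + Pi.single j 1 : Fin K → ℕ) k).factorial : ℕ) : ℝ) *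
                MvPolynomial.coeff (Finsupp.equivFunOnFinite.symm (γ + Pi.single i 1 + Pi.single j 1))
                  (Matrix.det (∑ l, (MvPolynomial.X l : MvPolynomial (Fin K) ℝ) • (A l).map MvPolynomial.C)))
            *ᵥ w)) ^ 2) := by
  obtain ⟨ha, hb, hc⟩ := DetLorentzianDefinite.isLorentzianArray_parts_abc_of_posDef 2 K A hA
  have hsymm : ∀ l, (A l).IsSymm := by
    intro l
    have h := (hA l).isHermitian
    unfold Matrix.IsHermitian at h
    rwa [Matrix.conjTranspose_eq_transpose_of_trivial] at h
  exact ⟨ha, hb, hc, atMostOnePosEig_hessAt_detArray_two K A hsymm⟩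

end DetLorentzianHessianTwo

end Summit.ValiantsHypothesis.ValiantsHypothesis.Theorems.LacunarySymmetroidMatrixDescartes

end
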